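import Summits.ValiantsHypothesis.ValiantsHypothesis.Theses.AnyonJets
import Summits.ValiantsHypothesis.ValiantsHypothesis.Theorems.TwoAdicLadderCeilingAllPrecisions
import Literature.Computability.AlgebraicComplexity.ConstantFreeCircuits
import Literature.Computability.AlgebraicComplexity.SkewCircuitFormalDegree

/-!
# Route `AnyonJets`, support item `JetFlatness` (stmt-ValiantsHypothesis-16741) — PROVED

**Item ("THE LEVER", card P1).** The inversion jets
`J_{n,k} = ∑_σ sgn σ · binom(inv σ, k) · ∏ᵢ X_{σ i, i} ∈ ℤ[X]` have CONSTANT-FREE circuits of size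
`τ(J_{n,k}) ≤ (n+2)^{4k+c₀} · (2k+2)!` for one absolute `c₀` and all `n, k`
(`Theses.AnyonJets.JetFlatness`; we get `c₀ = 7`, and the factorial is slack).

**Proof (Valiant's 2-locality of the inversion statistic, as already formalised for route
TwoAdicLadder).** Counting the `k`-subsets `P` of inverted column pairs,
`binom(inv σ, k) = #{P ⊆ pairs, |P| = k, σ inverts P}`, and for a fixed `P` the signed sum of the
monomials `x^σ` over the `σ` inverting every pair of `P` is the sum, over the ADMISSIBLE PINNINGS
`ρ` (to each pair `(a < b) ∈ P` a pair of rows `ρ₁ > ρ₂`), of the determinant of the generic matrix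
with column `a` pinned to its row-`ρ₁` entry and column `b` to its row-`ρ₂` entry
(`TwoAdicLadder.det_multipinned_eq`, `sum_ite_adm_match_eq`, `sum_powersetCard_ite_eq_choose` of
`TwoAdicLadderCeilingAllPrecisions.lean`, there used modulo `2^k`; here over `ℤ`):
`J_{n,k} = ∑_{|P| = k} ∑_{ρ admissible} det N_{P,ρ}` (`jet_eq_sum_multipinned`). Each `det N_{P,ρ}` is
a substitution instance (variables ↦ variables or `0`) of `det_n`, so
`τ(det N_{P,ρ}) ≤ τ(det_n) ≤ 4(n+1)⁴` by the tree's constant-free Berkowitz bound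
(`constantFreeComplexity_detPoly_le`, `constantFreeComplexity_aeval_le`); there are `≤ n^{2k}` sets
`P` and `n^{2k}` pinnings each, whence
`τ(J_{n,k}) ≤ n^{2k}(n^{2k}·4(n+1)⁴ + n^{2k}) + n^{2k} ≤ 6(n+2)^{4k+4} ≤ (n+2)^{4k+7}`
(`constantFreeComplexity_jet_le`, `jet_bound_arith`). For `k > n(n-1)/2` the sum is empty and
`J_{n,k} = 0`. HONEST FRAMING: an explicit polynomial-size (for fixed `k`) constant-free upper bound
for one family inside a dormant route; it says nothing about `VP ≠ VNP`, which is NOT proved.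

References: L. G. Valiant, *The complexity of computing the permanent*, TCS 8 (1979), §4 (per mod
`2^k` in `O(n^{4k-3})`: the 2-locality of inversions); P. Bürgisser, *Completeness and Reduction in
Algebraic Complexity Theory*, 2000, §2.1, Rem. 2.7 (cost of sums, substitution); S. J. Berkowitz 1984
(division-free determinant).
-/

noncomputable section

-- single-conjunct layout: Sub = Summit, duplicated namespace component intended
set_option linter.dupNamespace false

namespace Summit.ValiantsHypothesis.ValiantsHypothesis.Theorems.AnyonJets

namespace JetFlat

open MvPolynomial Literature.Computability.AlgebraicComplexity
open Summit.ValiantsHypothesis.ValiantsHypothesis.Theorems.TwoAdicLadder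

/-- `sgn σ • x = C(sgn σ) · x` for the `ℤˣ`-action on `ℤ[X]` (`sgn σ = ±1`). [folklore] -/
theorem sign_smul_eq_C_mul {n : ℕ} (σ : Equiv.Perm (Fin n)) (x : MvPolynomial (Fin n × Fin n) ℤ) :
    Equiv.Perm.sign σ • x = C ((Equiv.Perm.sign σ : ℤˣ) : ℤ) * x := by
  rcases Int.units_eq_one_or (Equiv.Perm.sign σ) with hs | hs
  · rw [hs, one_smul, Units.val_one, C_1, one_mul]
  · rw [hs, Units.neg_smul, one_smul, Units.val_neg, Units.val_one, C_neg, C_1, neg_one_mul]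

/-- **The jets as sums of multi-pinned determinants** (over `ℤ`):
`J_{n,k} = ∑_{P ⊆ pairs, |P| = k} ∑_{ρ admissible} det N_{P,ρ}` — Step A of
`TwoAdicLadder.perPoly_eq_sum_multipinned`, without the reduction modulo `2^k`.
[cite: Valiant1979Permanent, §4] -/
theorem jet_eq_sum_multipinned (n k : ℕ) :
    (∑ σ : Equiv.Perm (Fin n), C (((Equiv.Perm.sign σ : ℤˣ) : ℤ) *
        (((Finset.univ.filter (fun p : Fin n × Fin n => p.1 < p.2 ∧ σ p.2 < σ p.1)).card.choose k : ℕ) : ℤ)) *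
      ∏ i : Fin n, X (σ i, i) : MvPolynomial (Fin n × Fin n) ℤ) =
    ∑ P ∈ ((Finset.univ : Finset (Fin n × Fin n)).filter (fun p => p.1 < p.2)).powersetCard k,
      ∑ ρ : P → Fin n × Fin n,
        if (∀ p : P, (ρ p).2 < (ρ p).1) then
          (Matrix.of fun r c : Fin n =>
            if (∀ p : P, (c = p.1.1 → r = (ρ p).1) ∧ (c = p.1.2 → r = (ρ p).2)) then
              (X (r, c) : MvPolynomial (Fin n × Fin n) ℤ) else 0).det
        else 0 := by
  classical
  have step : ∀ (P : Finset (Fin n × Fin n)) (ρ : P → Fin n × Fin n),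
      (if (∀ p : P, (ρ p).2 < (ρ p).1) then
        (Matrix.of fun r c : Fin n =>
          if (∀ p : P, (c = p.1.1 → r = (ρ p).1) ∧ (c = p.1.2 → r = (ρ p).2)) then
            (X (r, c) : MvPolynomial (Fin n × Fin n) ℤ) else 0).det
        else 0) = ∑ σ : Equiv.Perm (Fin n),
        (if (∀ p : P, (ρ p).2 < (ρ p).1) ∧ (∀ p : P, σ p.1.1 = (ρ p).1 ∧ σ p.1.2 = (ρ p).2)
          then (1 : MvPolynomial (Fin n × Fin n) ℤ) else 0) *
          (Equiv.Perm.sign σ • ∏ c, (X (σ c, c) : MvPolynomial (Fin n × Fin n) ℤ)) := by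
    intro P ρ
    rw [det_multipinned_eq]
    split_ifs with hadm
    · refine Finset.sum_congr rfl fun σ _ => ?_
      by_cases hm : ∀ p : P, σ p.1.1 = (ρ p).1 ∧ σ p.1.2 = (ρ p).2
      · rw [if_pos hm, if_pos ⟨hadm, hm⟩, one_mul]
      · rw [if_neg hm, if_neg (fun h => hm h.2), zero_mul]
    · symm
      refine Finset.sum_eq_zero fun σ _ => ?_
      rw [if_neg (fun h => hadm h.1), zero_mul]
  symm
  simp_rw [step]
  rw [Finset.sum_congr rfl fun P _ => Finset.sum_comm, Finset.sum_comm]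
  refine Finset.sum_congr rfl fun σ _ => ?_
  simp_rw [← Finset.sum_mul]
  simp_rw [sum_ite_adm_match_eq]
  rw [sum_powersetCard_ite_eq_choose k σ, sign_smul_eq_C_mul, ← mul_assoc, ← map_natCast C, ← map_mul,
    mul_comm (((Finset.univ.filter (fun p : Fin n × Fin n => p.1 < p.2 ∧ σ p.2 < σ p.1)).card.choose k
      : ℕ) : ℤ)]

/-- `τ(det N_{P,ρ}) ≤ τ(det_n)`: the multi-pinned determinant is a substitution instance of `det_n`
by variables and zeros, which are free in constant-free circuits
(`constantFreeComplexity_aeval_le`). [cite: Burgisser2000, Rem. 2.7] -/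
theorem constantFreeComplexity_det_multipinned_le {n : ℕ} (P : Finset (Fin n × Fin n))
    (ρ : P → Fin n × Fin n) :
    constantFreeComplexity (Matrix.of fun r c : Fin n =>
        if (∀ p : P, (c = p.1.1 → r = (ρ p).1) ∧ (c = p.1.2 → r = (ρ p).2)) then
          (X (r, c) : MvPolynomial (Fin n × Fin n) ℤ) else 0).det ≤
      constantFreeComplexity (detPoly (Fin n) ℤ) := by
  rw [det_multipinned_eq_aeval]
  refine (constantFreeComplexity_aeval_le _ _).trans ?_
  have h0 : ∀ v : Fin n × Fin n, constantFreeComplexity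
      (if (∀ p : P, (v.2 = p.1.1 → v.1 = (ρ p).1) ∧ (v.2 = p.1.2 → v.1 = (ρ p).2)) then
        (X v : MvPolynomial (Fin n × Fin n) ℤ) else 0) = 0 := by
    intro v
    split_ifs
    · exact constantFreeComplexity_X v
    · exact constantFreeComplexity_zero
  simp only [h0, Finset.sum_const_zero, add_zero, le_refl]

/-- **Size of the jet**: `τ(J_{n,k}) ≤ n^{2k} (n^{2k} τ(det_n) + n^{2k}) + n^{2k}` (at most `n^{2k}` sets
`P`, `n^{2k}` pinnings each, one `det_n`-instance per pinning; constant-free version of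
`TwoAdicLadder.complexity_multipinned_layer_le`). [cite: Burgisser2000, §2.1] -/
theorem constantFreeComplexity_jet_le (n k : ℕ) :
    constantFreeComplexity (∑ σ : Equiv.Perm (Fin n), C (((Equiv.Perm.sign σ : ℤˣ) : ℤ) *
        (((Finset.univ.filter (fun p : Fin n × Fin n => p.1 < p.2 ∧ σ p.2 < σ p.1)).card.choose k : ℕ) : ℤ)) *
      ∏ i : Fin n, X (σ i, i) : MvPolynomial (Fin n × Fin n) ℤ) ≤
      (n * n) ^ k * ((n * n) ^ k * constantFreeComplexity (detPoly (Fin n) ℤ) + (n * n) ^ k) +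
        (n * n) ^ k := by
  classical
  rw [jet_eq_sum_multipinned]
  set U := (Finset.univ : Finset (Fin n × Fin n)).filter (fun p => p.1 < p.2) with hU
  have hUc : U.card ≤ n * n :=
    (Finset.card_filter_le _ _).trans (by simp [Finset.card_univ, Fintype.card_prod])
  have hpc : (U.powersetCard k).card ≤ (n * n) ^ k := by
    rw [Finset.card_powersetCard]
    exact (Nat.choose_le_pow _ _).trans (Nat.pow_le_pow_left hUc k)
  have hinner : ∀ P ∈ U.powersetCard k, constantFreeComplexity (∑ ρ : P → Fin n × Fin n,
      if (∀ p : P, (ρ p).2 < (ρ p).1) then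
        (Matrix.of fun r c : Fin n =>
          if (∀ p : P, (c = p.1.1 → r = (ρ p).1) ∧ (c = p.1.2 → r = (ρ p).2)) then
            (X (r, c) : MvPolynomial (Fin n × Fin n) ℤ) else 0).det
      else 0) ≤ (n * n) ^ k * constantFreeComplexity (detPoly (Fin n) ℤ) + (n * n) ^ k := by
    intro P hP
    have hcardP : P.card = k := (Finset.mem_powersetCard.1 hP).2
    have hcardρ : (Finset.univ : Finset (P → Fin n × Fin n)).card = (n * n) ^ k := by
      rw [Finset.card_univ, Fintype.card_fun, Fintype.card_coe, hcardP, Fintype.card_prod,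
        Fintype.card_fin]
    refine (constantFreeComplexity_finset_sum_le _ _).trans ?_
    rw [hcardρ]
    refine Nat.add_le_add_right ?_ _
    have hterm : ∀ ρ ∈ (Finset.univ : Finset (P → Fin n × Fin n)), constantFreeComplexity
        (if (∀ p : P, (ρ p).2 < (ρ p).1) then
          (Matrix.of fun r c : Fin n =>
            if (∀ p : P, (c = p.1.1 → r = (ρ p).1) ∧ (c = p.1.2 → r = (ρ p).2)) then
              (X (r, c) : MvPolynomial (Fin n × Fin n) ℤ) else 0).det
          else 0) ≤ constantFreeComplexity (detPoly (Fin n) ℤ) := by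
      intro ρ _
      split_ifs
      · exact constantFreeComplexity_det_multipinned_le _ _
      · rw [constantFreeComplexity_zero]
        exact Nat.zero_le _
    refine (Finset.sum_le_card_nsmul _ _ _ hterm).trans ?_
    rw [hcardρ, smul_eq_mul]
  refine (constantFreeComplexity_finset_sum_le _ _).trans ?_
  refine Nat.add_le_add ?_ hpc
  refine (Finset.sum_le_card_nsmul _ _ _ hinner).trans ?_
  rw [smul_eq_mul]
  exact Nat.mul_le_mul_right _ hpc

/-- **Arithmetic**: with `τ(det_n) ≤ 4(n+1)⁴`,
`n^{2k}(n^{2k}·4(n+1)⁴ + n^{2k}) + n^{2k} ≤ (n+2)^{4k+7}`. [folklore] -/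
theorem jet_bound_arith (n k D : ℕ) (hD : D ≤ 4 * (n + 1) ^ 4) :
    (n * n) ^ k * ((n * n) ^ k * D + (n * n) ^ k) + (n * n) ^ k ≤ (n + 2) ^ (4 * k + 7) := by
  set m := n + 2 with hm
  have hm2 : 2 ≤ m := by omega
  have hm1 : 1 ≤ m := by omega
  have hB : (n * n) ^ k ≤ m ^ (2 * k) := by
    rw [pow_mul]
    exact Nat.pow_le_pow_left (by nlinarith) k
  have hD' : D ≤ 4 * m ^ 4 :=
    hD.trans (Nat.mul_le_mul_left 4 (Nat.pow_le_pow_left (by omega) 4))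
  have h1 : (n * n) ^ k * ((n * n) ^ k * D + (n * n) ^ k) + (n * n) ^ k ≤
      m ^ (2 * k) * (m ^ (2 * k) * (4 * m ^ 4) + m ^ (2 * k)) + m ^ (2 * k) := by
    gcongr
  refine h1.trans ?_
  have e1 : m ^ (2 * k) * (m ^ (2 * k) * (4 * m ^ 4) + m ^ (2 * k)) + m ^ (2 * k) =
      4 * m ^ (4 * k + 4) + m ^ (4 * k) + m ^ (2 * k) := by ring
  rw [e1]
  have h2 : m ^ (4 * k) ≤ m ^ (4 * k + 4) := Nat.pow_le_pow_right hm1 (by omega)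
  have h3 : m ^ (2 * k) ≤ m ^ (4 * k + 4) := Nat.pow_le_pow_right hm1 (by omega)
  have h4 : 8 ≤ m ^ 3 := by
    calc (8 : ℕ) = 2 ^ 3 := by norm_num
      _ ≤ m ^ 3 := Nat.pow_le_pow_left hm2 3
  calc 4 * m ^ (4 * k + 4) + m ^ (4 * k) + m ^ (2 * k) ≤ 6 * m ^ (4 * k + 4) := by omega
    _ ≤ m ^ 3 * m ^ (4 * k + 4) := Nat.mul_le_mul_right _ (by omega)
    _ = m ^ (4 * k + 7) := by rw [← pow_add]; ring_nf

end JetFlat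

open MvPolynomial Literature.Computability.AlgebraicComplexity

/-- **Settles `stmt-ValiantsHypothesis-16741` (support `JetFlatness`, route AnyonJets):**
`τ(J_{n,k}) ≤ (n+2)^{4k+7} · (2k+2)!` for all `n, k` — the multi-pinned Laplace expansion
(`JetFlat.constantFreeComplexity_jet_le`), the constant-free Berkowitz bound
`constantFreeComplexity_detPoly_le` (`τ(det_n) ≤ 4(n+1)⁴`) and `JetFlat.jet_bound_arith`; the
factorial factor is not needed. [cite: Valiant1979Permanent, §4] [cite: Burgisser2000, §2.1] -/
theorem jetFlatness_proof :
    Summit.ValiantsHypothesis.ValiantsHypothesis.Theses.AnyonJets.JetFlatness := by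
  dsimp only [Summit.ValiantsHypothesis.ValiantsHypothesis.Theses.AnyonJets.JetFlatness]
  refine ⟨7, fun n k => ?_⟩
  refine (JetFlat.constantFreeComplexity_jet_le n k).trans ?_
  refine (JetFlat.jet_bound_arith n k _ (constantFreeComplexity_detPoly_le n)).trans ?_
  exact Nat.le_mul_of_pos_right _ (Nat.factorial_pos _)

end Summit.ValiantsHypothesis.ValiantsHypothesis.Theorems.AnyonJets

end
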